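import Mathlib
import HarnessLib
import Summits.Ventures.LatticeQCDFlow.Exactness.SampleESS
import Summits.Ventures.LatticeQCDFlow.Scoring.UncorrectedFlowBias
import Summits.Ventures.LatticeQCDFlow.Scoring.UStatisticVariance

/-!
# LatticeQCDFlow / Scoring — the unbiased weight-variance statistic behind the ESS monitor has
# variance `(μ₄ − V²)/n + 2V²/(n(n − 1))` EXACTLY (`V = 1/ESS − 1`, `μ₄` the fourth central weight
# moment): no distribution-free error bar for the ESS monitor exists, in contrast with the
# acceptance monitor

HONEST FRAMING: exact (Metropolis-corrected) sampling algorithms for lattice gauge theory;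
figures of merit are autocorrelation/cost numbers at stated couplings and volumes; no
continuum-physics claim.

Venture `LatticeQCDFlow` (cell pub-lqcd), sub-topic `Scoring`; FANOUT row 3 (`s0-u1-a`, S0-B
implementation A, GEN-8).  NEW WORK of the cell (the kernel `(w − w′)²/2` inserted in Hoeffding's
exact law, row 3's `Scoring/UStatisticVariance`, imported; two weight-moment computations; an
algebraic identity for the printed Kish fraction), not a published result; NO definition is
introduced (`essHat` is row 2's `Exactness/SampleESS`, `essFrac`/`weight` row 29's
`Scaling/ImportanceWeights`).  Printed counterpart NAMED ONLY: the classical variance of the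
unbiased sample variance, `Var s² = (μ₄ − σ⁴(n − 3)/(n − 1))/n`.

## Setting (finite `X`; target `p` and model `q > 0` normalised; `w = p/q`, `E_q w = 1`;
## `V = Σ_x q_x (w_x − 1)² = Var_q w = 1/ESS − 1` (row 3's `model_variance_weight_eq`),
## `μ₄ = Σ_x q_x (w_x − 1)⁴`; `n ≥ 2` i.i.d. proposals with law `blockProd (fun _ ↦ q)`;
## `S² = Σ_{(i,j) ∈ offDiag} (w_i − w_j)²/2 / (n(n−1))`, the unbiased statistic for `V`)

* `condMean_half_sq_sub_weight` — `Σ_y q_y (w_x − w_y)²/2 = ((w_x − 1)² + V)/2`;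
  `qq_half_sq_sub_weight` — `E S² = E_{q⊗q}(w − w′)²/2 = V`; `q_condMean_half_sq_sub_weight_sq`,
  `qq_half_sq_sub_weight_sq` — Hoeffding's `c₁ = (μ₄ + 3V²)/4`, `c₂ = (μ₄ + 3V²)/2` for this kernel;
* **`variance_weightVar_eq`** — `E[(S² − V)²] = ((n − 1)μ₄ − (n − 3)V²)/(n(n − 1))`, and
  **`variance_weightVar_eq'`** — `= (μ₄ − V²)/n + 2V²/(n(n − 1))` (both terms non-negative:
  `sq_modelVar_le_fourthMoment`, `V² ≤ μ₄`); **`variance_weightVar_eq_essFrac`** — the same with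
  `V = 1/ESS − 1`;
* **`one_sub_essHat_eq`** — for ANY batch `W : Fin n → ℝ` with `Σ W² ≠ 0`: the printed Kish
  fraction `essHat W = (ΣW)²/(nΣW²)` obeys `1 − essHat W = (n − 1)·S²(W)/ΣW²` EXACTLY, so the ESS
  monitor is a fixed function of the ratio of `S²` to the batch mean square;
* **`exists_variance_weightVar_gt`** — NO DISTRIBUTION-FREE LAW: for every `n ≥ 2`, every
  `V > 0` (every population `ESS = 1/(1 + V) < 1`) and every `B`, a normalised pair on two points
  (`q > 0`, `p ≥ 0`) with `Var_q w = V` and `E[(S² − V)²] > B` (model mass `s²/(V + s²)` on a heavy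
  point of weight `1 + V/s`, `s → 0`: `μ₄ ≥ V⁴/(s²(V + s²))`).  Contrast: the pair-min ACCEPTANCE
  statistic has variance `≤ (n + 1)/(n(n − 1))` for every flow (row 3's
  `Scoring/PairAcceptanceVarianceSharp`).

NOT CLAIMED: the sampling law of the SELF-NORMALISED `essHat` itself (a ratio; only the identity
`one_sub_essHat_eq` and the law of its numerator statistic `S²` are typed); any ESS, `V`, `μ₄` or
error bar of ours; concentration beyond Chebyshev; nothing re-scored.
-/

namespace Summit.Ventures.LatticeQCDFlow.Scoring

open Finset
open Summit.Ventures.LatticeQCDFlow.Exactness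
open Summit.Ventures.LatticeQCDFlow.Theory2

section WeightVar

variable {X : Type*} [Fintype X] {n : ℕ}

/-- **Conditional mean of the kernel**: `Σ_y q_y (w_x − w_y)²/2 = ((w_x − 1)² + V)/2`
(`E_q w = 1`). [folklore] -/
theorem condMean_half_sq_sub_weight {p q : X → ℝ} (hq : ∀ x, 0 < q x) (hp1 : ∑ x, p x = 1)
    (hq1 : ∑ x, q x = 1) (x : X) :
    ∑ y, q y * ((weight p q x - weight p q y) ^ 2 / 2)
      = ((weight p q x - 1) ^ 2 + ∑ y, q y * (weight p q y - 1) ^ 2) / 2 := by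
  have M1 : ∑ y, q y * (weight p q y - 1) = 0 := by
    simp only [mul_sub, sum_sub_distrib, mul_one, sum_mul_weight hq hp1, hq1, sub_self]
  have e : ∀ y, q y * ((weight p q x - weight p q y) ^ 2 / 2)
      = (weight p q x - 1) ^ 2 / 2 * q y - (weight p q x - 1) * (q y * (weight p q y - 1))
        + (1 / 2) * (q y * (weight p q y - 1) ^ 2) := fun y => by ring
  simp_rw [e]
  rw [sum_add_distrib, sum_sub_distrib, ← mul_sum, ← mul_sum, ← mul_sum, hq1, M1]
  ring

/-- **Unbiasedness**: `E_{q⊗q} (w − w′)²/2 = V = Σ_x q_x (w_x − 1)²`. [folklore] -/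
theorem qq_half_sq_sub_weight {p q : X → ℝ} (hq : ∀ x, 0 < q x) (hp1 : ∑ x, p x = 1)
    (hq1 : ∑ x, q x = 1) :
    ∑ x, ∑ y, q x * q y * ((weight p q x - weight p q y) ^ 2 / 2)
      = ∑ x, q x * (weight p q x - 1) ^ 2 := by
  have e : ∀ x, ∑ y, q x * q y * ((weight p q x - weight p q y) ^ 2 / 2)
      = (1 / 2) * (q x * (weight p q x - 1) ^ 2)
        + (1 / 2) * (∑ y, q y * (weight p q y - 1) ^ 2) * q x := by
    intro x
    have h1 : ∑ y, q x * q y * ((weight p q x - weight p q y) ^ 2 / 2)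
        = q x * ∑ y, q y * ((weight p q x - weight p q y) ^ 2 / 2) := by
      rw [mul_sum]
      exact sum_congr rfl fun y _ => by ring
    rw [h1, condMean_half_sq_sub_weight hq hp1 hq1 x]
    ring
  simp_rw [e]
  rw [sum_add_distrib, ← mul_sum, ← mul_sum, hq1]
  ring

/-- **Hoeffding's `c₁`** for the kernel `(w − w′)²/2`: `Σ_x q_x h(x)² = (μ₄ + 3V²)/4`. [folklore] -/
theorem q_condMean_half_sq_sub_weight_sq {p q : X → ℝ} (hq : ∀ x, 0 < q x) (hp1 : ∑ x, p x = 1)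
    (hq1 : ∑ x, q x = 1) :
    ∑ x, q x * (∑ y, q y * ((weight p q x - weight p q y) ^ 2 / 2)) ^ 2
      = ((∑ x, q x * (weight p q x - 1) ^ 4) + 3 * (∑ x, q x * (weight p q x - 1) ^ 2) ^ 2) / 4 := by
  simp_rw [condMean_half_sq_sub_weight hq hp1 hq1]
  set V := ∑ x, q x * (weight p q x - 1) ^ 2 with hV
  have e : ∀ x, q x * (((weight p q x - 1) ^ 2 + V) / 2) ^ 2
      = (1 / 4) * (q x * (weight p q x - 1) ^ 4) + (V / 2) * (q x * (weight p q x - 1) ^ 2)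
        + (V ^ 2 / 4) * q x := fun x => by ring
  simp_rw [e]
  rw [sum_add_distrib, sum_add_distrib, ← mul_sum, ← mul_sum, ← mul_sum, hq1, ← hV]
  ring

/-- **Hoeffding's `c₂`** for the kernel `(w − w′)²/2`: `E_{q⊗q} ((w − w′)²/2)² = (μ₄ + 3V²)/2`
(`E(A − B)⁴ = 2μ₄ + 6V²` for independent centred copies). [folklore] -/
theorem qq_half_sq_sub_weight_sq {p q : X → ℝ} (hq : ∀ x, 0 < q x) (hp1 : ∑ x, p x = 1)
    (hq1 : ∑ x, q x = 1) :
    ∑ x, ∑ y, q x * q y * ((weight p q x - weight p q y) ^ 2 / 2) ^ 2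
      = ((∑ x, q x * (weight p q x - 1) ^ 4) + 3 * (∑ x, q x * (weight p q x - 1) ^ 2) ^ 2) / 2 := by
  have M1 : ∑ y, q y * (weight p q y - 1) = 0 := by
    simp only [mul_sub, sum_sub_distrib, mul_one, sum_mul_weight hq hp1, hq1, sub_self]
  set V := ∑ x, q x * (weight p q x - 1) ^ 2 with hV
  set M3 := ∑ x, q x * (weight p q x - 1) ^ 3 with hM3
  set M4 := ∑ x, q x * (weight p q x - 1) ^ 4 with hM4
  -- inner sum over `y`
  have inner : ∀ x, ∑ y, q y * ((weight p q x - weight p q y) ^ 2 / 2) ^ 2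
      = ((weight p q x - 1) ^ 4 + 6 * V * (weight p q x - 1) ^ 2
          - 4 * M3 * (weight p q x - 1) + M4) / 4 := by
    intro x
    have e : ∀ y, q y * ((weight p q x - weight p q y) ^ 2 / 2) ^ 2
        = (weight p q x - 1) ^ 4 / 4 * q y
          - (weight p q x - 1) ^ 3 * (q y * (weight p q y - 1))
          + (3 / 2) * (weight p q x - 1) ^ 2 * (q y * (weight p q y - 1) ^ 2)
          - (weight p q x - 1) * (q y * (weight p q y - 1) ^ 3)
          + (1 / 4) * (q y * (weight p q y - 1) ^ 4) := fun y => by ring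
    simp_rw [e]
    rw [sum_add_distrib, sum_sub_distrib, sum_add_distrib, sum_sub_distrib, ← mul_sum, ← mul_sum,
      ← mul_sum, ← mul_sum, ← mul_sum, hq1, M1, ← hV, ← hM3, ← hM4]
    ring
  have e2 : ∀ x, ∑ y, q x * q y * ((weight p q x - weight p q y) ^ 2 / 2) ^ 2
      = (1 / 4) * (q x * (weight p q x - 1) ^ 4) + (3 / 2 * V) * (q x * (weight p q x - 1) ^ 2)
        - M3 * (q x * (weight p q x - 1)) + (M4 / 4) * q x := by
    intro x
    have h1 : ∑ y, q x * q y * ((weight p q x - weight p q y) ^ 2 / 2) ^ 2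
        = q x * ∑ y, q y * ((weight p q x - weight p q y) ^ 2 / 2) ^ 2 := by
      rw [mul_sum]
      exact sum_congr rfl fun y _ => by ring
    rw [h1, inner x]
    ring
  simp_rw [e2]
  rw [sum_add_distrib, sum_sub_distrib, sum_add_distrib, ← mul_sum, ← mul_sum, ← mul_sum, ← mul_sum,
    hq1, M1, ← hV, ← hM4]
  ring

/-- **`V² ≤ μ₄`** (Jensen): the fourth central moment dominates the squared variance. [folklore] -/
theorem sq_modelVar_le_fourthMoment {p q : X → ℝ} (hq : ∀ x, 0 < q x) (hq1 : ∑ x, q x = 1) :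
    (∑ x, q x * (weight p q x - 1) ^ 2) ^ 2 ≤ ∑ x, q x * (weight p q x - 1) ^ 4 := by
  have hv := varLaw_nonneg (fun x => (hq x).le) hq1 (fun x => (weight p q x - 1) ^ 2)
  unfold varLaw at hv
  have e : ∀ x, q x * ((weight p q x - 1) ^ 2) ^ 2 = q x * (weight p q x - 1) ^ 4 :=
    fun x => by ring
  simp_rw [e] at hv
  linarith

/-- **The exact variance of the unbiased weight-variance statistic.**  For a positive normalised
model `q`, a normalised target `p`, `w = p/q` and `n ≥ 2` i.i.d. proposals:
`E[(S² − V)²] = ((n − 1)μ₄ − (n − 3)V²) / (n(n − 1))` with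
`S² = Σ_{i≠j} (w_i − w_j)²/2 / (n(n−1))`, `V = Σ q (w − 1)²`, `μ₄ = Σ q (w − 1)⁴` — Hoeffding's
law `(2ζ₂ + 4(n−2)ζ₁)/(n(n−1))` with `ζ₁ = (μ₄ − V²)/4`, `ζ₂ = (μ₄ + V²)/2`. [folklore] -/
theorem variance_weightVar_eq {p q : X → ℝ} (hq : ∀ x, 0 < q x) (hp1 : ∑ x, p x = 1)
    (hq1 : ∑ x, q x = 1) (hn : 2 ≤ n) :
    ∑ φ : Fin n → X, blockProd (fun _ => q) φ
        * ((∑ z ∈ (univ : Finset (Fin n)).offDiag,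
              (weight p q (φ z.1) - weight p q (φ z.2)) ^ 2 / 2) / ((n : ℝ) * (n - 1))
            - ∑ x, q x * (weight p q x - 1) ^ 2) ^ 2
      = (((n : ℝ) - 1) * (∑ x, q x * (weight p q x - 1) ^ 4)
          - ((n : ℝ) - 3) * (∑ x, q x * (weight p q x - 1) ^ 2) ^ 2) / ((n : ℝ) * (n - 1)) := by
  have hF : ∀ x y, (weight p q x - weight p q y) ^ 2 / 2 = (weight p q y - weight p q x) ^ 2 / 2 :=
    fun x y => by ring
  have key : ∑ φ : Fin n → X, blockProd (fun _ => q) φ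
        * ((∑ z ∈ (univ : Finset (Fin n)).offDiag,
              (weight p q (φ z.1) - weight p q (φ z.2)) ^ 2 / 2) / ((n : ℝ) * (n - 1))
            - ∑ x, ∑ y, q x * q y * ((weight p q x - weight p q y) ^ 2 / 2)) ^ 2
      = (2 * ((∑ x, ∑ y, q x * q y * ((weight p q x - weight p q y) ^ 2 / 2) ^ 2)
            - (∑ x, ∑ y, q x * q y * ((weight p q x - weight p q y) ^ 2 / 2)) ^ 2)
          + 4 * ((n : ℝ) - 2) * ((∑ x, q x * (∑ y, q y * ((weight p q x - weight p q y) ^ 2 / 2)) ^ 2)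
            - (∑ x, ∑ y, q x * q y * ((weight p q x - weight p q y) ^ 2 / 2)) ^ 2))
          / ((n : ℝ) * (n - 1)) :=
    variance_ustat₂_eq q hq1 (F := fun x y => (weight p q x - weight p q y) ^ 2 / 2) hF hn
  rw [qq_half_sq_sub_weight_sq hq hp1 hq1, q_condMean_half_sq_sub_weight_sq hq hp1 hq1,
    qq_half_sq_sub_weight hq hp1 hq1] at key
  rw [key]
  congr 1
  ring

/-- **The same, split into two non-negative terms**: `E[(S² − V)²] = (μ₄ − V²)/n + 2V²/(n(n − 1))`
— the kurtosis term `(μ₄ − V²)/n` is Hoeffding's lower bound `4ζ₁/n`. [folklore] -/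
theorem variance_weightVar_eq' {p q : X → ℝ} (hq : ∀ x, 0 < q x) (hp1 : ∑ x, p x = 1)
    (hq1 : ∑ x, q x = 1) (hn : 2 ≤ n) :
    ∑ φ : Fin n → X, blockProd (fun _ => q) φ
        * ((∑ z ∈ (univ : Finset (Fin n)).offDiag,
              (weight p q (φ z.1) - weight p q (φ z.2)) ^ 2 / 2) / ((n : ℝ) * (n - 1))
            - ∑ x, q x * (weight p q x - 1) ^ 2) ^ 2
      = ((∑ x, q x * (weight p q x - 1) ^ 4) - (∑ x, q x * (weight p q x - 1) ^ 2) ^ 2) / (n : ℝ)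
          + 2 * (∑ x, q x * (weight p q x - 1) ^ 2) ^ 2 / ((n : ℝ) * (n - 1)) := by
  rw [variance_weightVar_eq hq hp1 hq1 hn]
  have h2 : (2 : ℝ) ≤ n := by exact_mod_cast hn
  have hn0 : (n : ℝ) ≠ 0 := by positivity
  have hn1 : (n : ℝ) - 1 ≠ 0 := (by linarith : (0 : ℝ) < n - 1).ne'
  field_simp
  ring

/-- **In terms of the population ESS fraction**: `V = 1/ESS − 1` (row 3's
`model_variance_weight_eq`), so `E[(S² − (1/ESS − 1))²] = (μ₄ − (1/ESS − 1)²)/n +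
2(1/ESS − 1)²/(n(n − 1))`. [folklore] -/
theorem variance_weightVar_eq_essFrac {p q : X → ℝ} (hq : ∀ x, 0 < q x) (hp1 : ∑ x, p x = 1)
    (hq1 : ∑ x, q x = 1) (hn : 2 ≤ n) :
    ∑ φ : Fin n → X, blockProd (fun _ => q) φ
        * ((∑ z ∈ (univ : Finset (Fin n)).offDiag,
              (weight p q (φ z.1) - weight p q (φ z.2)) ^ 2 / 2) / ((n : ℝ) * (n - 1))
            - ((essFrac p q)⁻¹ - 1)) ^ 2
      = ((∑ x, q x * (weight p q x - 1) ^ 4) - ((essFrac p q)⁻¹ - 1) ^ 2) / (n : ℝ)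
          + 2 * ((essFrac p q)⁻¹ - 1) ^ 2 / ((n : ℝ) * (n - 1)) := by
  rw [← model_variance_weight_eq hq hp1 hq1]
  exact variance_weightVar_eq' hq hp1 hq1 hn

/-! ### The printed Kish fraction is a fixed function of `S² / (batch mean square)` -/

/-- `Σ_{(i,j) ∈ offDiag} g(i,j) = Σ_i Σ_j g(i,j) − Σ_i g(i,i)`. [folklore] -/
theorem sum_offDiag_eq_sum_sum_sub {g : Fin n → Fin n → ℝ} :
    ∑ z ∈ (univ : Finset (Fin n)).offDiag, g z.1 z.2 = (∑ i, ∑ j, g i j) - ∑ i, g i i := by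
  have hu := sum_union (disjoint_diag_offDiag (s := (univ : Finset (Fin n))))
    (f := fun z : Fin n × Fin n => g z.1 z.2)
  rw [diag_union_offDiag, sum_product', sum_diag] at hu
  linarith

/-- **`1 − essHat W = (n − 1)·S²(W)/ΣW²`** for every batch `W : Fin n → ℝ` with `ΣW² ≠ 0`
(`n ≥ 2`), where `essHat W = (ΣW)²/(nΣW²)` is the printed Kish fraction and
`S²(W) = Σ_{i≠j}(W_i − W_j)²/2/(n(n−1))` the unbiased variance statistic: the ESS monitor is the
fixed decreasing function `1 − (n−1)·S²/ΣW²` of the ratio of `S²` to the batch mean square.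
[folklore] -/
theorem one_sub_essHat_eq (W : Fin n → ℝ) (hW : ∑ i, W i ^ 2 ≠ 0) (hn : 2 ≤ n) :
    1 - essHat W
      = ((n : ℝ) - 1) * ((∑ z ∈ (univ : Finset (Fin n)).offDiag, (W z.1 - W z.2) ^ 2 / 2)
          / ((n : ℝ) * (n - 1))) / ∑ i, W i ^ 2 := by
  have h2 : (2 : ℝ) ≤ n := by exact_mod_cast hn
  have hn0 : (n : ℝ) ≠ 0 := by positivity
  have hn1 : (n : ℝ) - 1 ≠ 0 := (by linarith : (0 : ℝ) < n - 1).ne'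
  have hoff : ∑ z ∈ (univ : Finset (Fin n)).offDiag, (W z.1 - W z.2) ^ 2 / 2
      = (n : ℝ) * ∑ i, W i ^ 2 - (∑ i, W i) ^ 2 := by
    rw [sum_offDiag_eq_sum_sum_sub (g := fun i j => (W i - W j) ^ 2 / 2)]
    have hd : ∑ i : Fin n, (W i - W i) ^ 2 / 2 = 0 := by simp
    rw [hd, sub_zero]
    have hc := card_mul_sum_sq_sub_sq_sum W
    rw [Fintype.card_fin] at hc
    rw [hc, mul_sum]
    refine sum_congr rfl fun i _ => ?_
    rw [mul_sum]
    exact sum_congr rfl fun j _ => by ring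
  unfold essHat
  rw [Fintype.card_fin, hoff]
  field_simp

/-! ### No distribution-free law: the variance of `S²` is unbounded at fixed ESS -/

/-- **No distribution-free error bar for the ESS monitor's statistic.**  For every `n ≥ 2`, every
`V > 0` (population `ESS = 1/(1 + V) < 1`) and every `B`, there is a normalised pair on two points
(`p ≥ 0`, `q > 0`) with `Var_q w = V` exactly and `E[(S² − V)²] > B`: model mass `s²/(V + s²)` on a
point of weight `1 + V/s` (and `V/(V + s²)` on a point of weight `1 − s`), `s ↓ 0`, has
`μ₄ ≥ V⁴/(s²(V + s²)) → ∞`.  Contrast: the pair-min acceptance statistic has variance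
`≤ (n + 1)/(n(n − 1))` for every flow. [folklore] -/
theorem exists_variance_weightVar_gt (hn : 2 ≤ n) {V : ℝ} (hV : 0 < V) (B : ℝ) :
    ∃ p q : Fin 2 → ℝ, (∀ x, 0 ≤ p x) ∧ (∀ x, 0 < q x) ∧ ∑ x, p x = 1 ∧ ∑ x, q x = 1 ∧
      ∑ x, q x * (weight p q x - 1) ^ 2 = V ∧
      B < ∑ φ : Fin n → Fin 2, blockProd (fun _ => q) φ
          * ((∑ z ∈ (univ : Finset (Fin n)).offDiag,
                (weight p q (φ z.1) - weight p q (φ z.2)) ^ 2 / 2) / ((n : ℝ) * (n - 1))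
              - ∑ x, q x * (weight p q x - 1) ^ 2) ^ 2 := by
  -- the parameters
  have h2 : (2 : ℝ) ≤ n := by exact_mod_cast hn
  have hnpos : (0 : ℝ) < n := by linarith
  have hn1 : (0 : ℝ) < n - 1 := by linarith
  set B' : ℝ := max B 0 + 1 with hB'
  have hB'pos : 0 < B' := by have := le_max_right B 0; linarith
  have hBB' : B < B' := by have := le_max_left B 0; linarith
  set T : ℝ := V ^ 4 / ((V + 1) * (n * B' + V ^ 2)) with hT
  have hTpos : 0 < T := by positivity
  set s : ℝ := min 1 T with hs
  have hs0 : 0 < s := lt_min one_pos hTpos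
  have hs1 : s ≤ 1 := min_le_left _ _
  have hsne : s ≠ 0 := hs0.ne'
  have hsT : s ^ 2 ≤ T := by
    rcases le_total T 1 with h | h
    · rw [min_eq_right h] at hs
      rw [hs]
      nlinarith
    · rw [min_eq_left h] at hs
      rw [hs]
      linarith
  set D : ℝ := V + s ^ 2 with hD
  have hDpos : 0 < D := by positivity
  have hDne : D ≠ 0 := hDpos.ne'
  have hVne : V ≠ 0 := hV.ne'
  -- the pair
  set p : Fin 2 → ℝ := ![V * (1 - s) / D, s * (s + V) / D] with hp
  set q : Fin 2 → ℝ := ![V / D, s ^ 2 / D] with hq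
  have hp0 : ∀ x, 0 ≤ p x := by
    intro x
    fin_cases x
    · exact div_nonneg (mul_nonneg hV.le (by linarith)) hDpos.le
    · exact div_nonneg (mul_nonneg hs0.le (by linarith)) hDpos.le
  have hqpos : ∀ x, 0 < q x := by
    intro x
    fin_cases x
    · exact div_pos hV hDpos
    · exact div_pos (pow_pos hs0 2) hDpos
  have hp1 : ∑ x, p x = 1 := by
    rw [Fin.sum_univ_two]
    show V * (1 - s) / D + s * (s + V) / D = 1
    rw [← add_div, div_eq_one_iff_eq hDne, hD]
    ring
  have hq1 : ∑ x, q x = 1 := by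
    rw [Fin.sum_univ_two]
    show V / D + s ^ 2 / D = 1
    rw [← add_div, div_eq_one_iff_eq hDne]
  have w0 : weight p q 0 = 1 - s := by
    show V * (1 - s) / D / (V / D) = 1 - s
    rw [div_div_div_cancel_right₀ hDne, mul_div_cancel_left₀ _ hVne]
  have w1 : weight p q 1 = (s + V) / s := by
    show s * (s + V) / D / (s ^ 2 / D) = (s + V) / s
    rw [div_div_div_cancel_right₀ hDne, sq, mul_div_mul_left _ _ hsne]
  have hw1 : (s + V) / s - 1 = V / s := by
    field_simp
    ring
  have hVeq : ∑ x, q x * (weight p q x - 1) ^ 2 = V := by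
    rw [Fin.sum_univ_two, w0, w1, hw1]
    show V / D * (1 - s - 1) ^ 2 + s ^ 2 / D * (V / s) ^ 2 = V
    field_simp
    ring
  have hM4 : ∑ x, q x * (weight p q x - 1) ^ 4 = V * s ^ 4 / D + V ^ 4 / (s ^ 2 * D) := by
    rw [Fin.sum_univ_two, w0, w1, hw1]
    show V / D * (1 - s - 1) ^ 4 + s ^ 2 / D * (V / s) ^ 4 = V * s ^ 4 / D + V ^ 4 / (s ^ 2 * D)
    field_simp
    ring
  refine ⟨p, q, hp0, hqpos, hp1, hq1, hVeq, ?_⟩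
  rw [variance_weightVar_eq' hqpos hp1 hq1 hn, hVeq, hM4]
  -- the kurtosis term alone exceeds `B'`
  have hsD : s ^ 2 * D ≤ T * (V + 1) := by
    refine mul_le_mul hsT ?_ hDpos.le hTpos.le
    rw [hD]
    nlinarith
  have hkey : n * B' + V ^ 2 ≤ V ^ 4 / (s ^ 2 * D) := by
    rw [le_div_iff₀ (by positivity)]
    calc (n * B' + V ^ 2) * (s ^ 2 * D) ≤ (n * B' + V ^ 2) * (T * (V + 1)) :=
          mul_le_mul_of_nonneg_left hsD (by positivity)
      _ = V ^ 4 := by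
          rw [hT]
          field_simp
  have hfirst : 0 ≤ V * s ^ 4 / D := by positivity
  have hsecond : 0 ≤ 2 * V ^ 2 / (n * (n - 1)) := by positivity
  have hmain : B' ≤ (V * s ^ 4 / D + V ^ 4 / (s ^ 2 * D) - V ^ 2) / n := by
    rw [le_div_iff₀ hnpos]
    linarith
  linarith

end WeightVar

end Summit.Ventures.LatticeQCDFlow.Scoring
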